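import Literature.Analysis.FunctionSpaces.TorusTrigPoly
import Literature.Analysis.FunctionSpaces.TorusFourierCalculus
import HarnessLib

/-!
# The smoothed step multiplier along one axis of `T^d`: symbol, kernel, and the kernel's first moment

Analysis/FunctionSpaces file (DEFINITIONS + proofs; no named facts).  For a coordinate `i : d`, a plateau
`K : ℕ` and a ramp `Δ ≥ 1`, the **smoothed step symbol** on `ℤ`

  `stepSym K Δ m = Δ⁻² · #{(a, a') ∈ [0,Δ)² : |m − a + a'| ≤ K + Δ}`

(the indicator of `[−K−Δ, K+Δ]` convolved with the Fejér weights `(Δ − |j|)₊/Δ²`) takes values in `[0,1]`,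
equals `1` for `|m| ≤ K`, vanishes for `|m| > K + 2Δ` and is even (`stepSym_*`).  Read on the `i`-th
coordinate of the frequency, `k ↦ stepSym K Δ (k i)`, it is the Fourier multiplier "low-pass in direction `i`";
its convolution kernel on `T^d` is the explicit trigonometric polynomial

  `stepKernel i K Δ y = Re( D_{K+Δ}(y_i) · |G_Δ(y_i)|² ) / Δ²`,
  `D_N = Σ_{|n|≤N} e^{2πi n y_i}` (Dirichlet), `G_Δ = Σ_{0≤a<Δ} e^{2πi a y_i}` (geometric sum, `|G_Δ|²/Δ` = Fejér),

(`integral_stepKernel_mul_mFourier_single`: `∫ k(y) e^{2πi m y_i} dy = stepSym K Δ m`; the kernel is real,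
`conj_stepKernelC`).  The point of the construction is the FIRST-MOMENT BOUND of the kernel in the transverse
coordinate, `∫_{T^d} |reprc y _i| · |stepKernel i K Δ y| dy ≤ 2/Δ` uniformly in the plateau length `K` — the
commutator constant of the multiplier with a Lipschitz function, `‖[ψ(Dᵢ), β]‖ ≤ Lip(β) · M₁` — proved in the
companion file `TorusAxisStepKernelMoment` (this file: the algebra; that file: the analysis); the one-dimensional
(axis-by-axis) form is what keeps the constant free of the `log(K/Δ)` Lebesgue-constant loss of product kernels (Grafakos, Classical Fourier Analysis, §3.1.3 (Fejér and
Dirichlet kernels), Prop. 3.1.2; DiPerna–Lions, Invent. Math. 98 (1989), §II.1 Lemma II.1 (commutator with a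
mollifier)).

Consumer: cell `ad-ideate`, K1L_D `stmt-AnomalousDissipation-27980`, W3-E (ii) `stub_effectiveFrameEnergyL_bandKill`
(cube cut-off ladder, finding F-k3l-7).

## Mathlib / tree search
Tree: `Torus.integral_mFourier_neg_mul_mFourier` (orthonormality, global volume), `Torus.mFourier_apply_add`, `Torus.trigPoly`.
Mathlib: `UnitAddTorus.mFourier`, `fourier_zero`, `fourier_eval_zero`, `Finset.sum_range_reflect`, `Complex.conj_eq_iff_re`.

## References
* L. Grafakos, *Classical Fourier Analysis*, 3rd ed., GTM 249 (2014), §3.1.3, Prop. 3.1.2. [`Grafakos2014`]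
* R. J. DiPerna, P.-L. Lions, Invent. Math. 98 (1989), §II.1 Lemma II.1. [`DiPernaLions1989`]
-/

noncomputable section

open MeasureTheory Set Filter Complex UnitAddTorus Function Finset
open scoped ENNReal InnerProductSpace ComplexConjugate

namespace Literature.Analysis.FunctionSpaces

namespace Torus

variable {d : Type*} [Fintype d] [DecidableEq d]

/-! ## §1 Characters along one axis -/

/-- `e_{n eᵢ}(y) = fourier n (yᵢ)`. [cite: Grafakos2014, §3.1.1] -/
theorem mFourier_single_int (i : d) (n : ℤ) (y : UnitAddTorus d) :
    mFourier (Pi.single i n) y = fourier n (y i) := by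
  simp_rw [mFourier, ContinuousMap.coe_mk]
  rw [← Finset.prod_erase_mul _ _ (Finset.mem_univ i), Pi.single_eq_same]
  rw [Finset.prod_eq_one fun j hj => ?_, one_mul]
  rw [Finset.mem_erase] at hj
  rw [Pi.single_eq_of_ne hj.1, fourier_zero]

/-- `e_k(tᵢ-spike) = fourier (kᵢ) t`: a character evaluated at a point with a single nonzero coordinate.
[cite: Grafakos2014, §3.1.1] -/
theorem mFourier_apply_pi_single (k : d → ℤ) (i : d) (t : UnitAddCircle) :
    mFourier k (Pi.single i t : UnitAddTorus d) = fourier (k i) t := by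
  simp_rw [mFourier, ContinuousMap.coe_mk]
  rw [← Finset.prod_erase_mul _ _ (Finset.mem_univ i), Pi.single_eq_same]
  rw [Finset.prod_eq_one fun j hj => ?_, one_mul]
  rw [Finset.mem_erase] at hj
  rw [Pi.single_eq_of_ne hj.1, fourier_eval_zero]

/-- `e_k(x + yᵢ-spike) = e_k(x) · e_{kᵢ eᵢ}(y)`. [cite: Grafakos2014, §3.1.1] -/
theorem mFourier_add_pi_single (k : d → ℤ) (i : d) (x y : UnitAddTorus d) :
    mFourier k (x + Pi.single i (y i)) = mFourier k x * mFourier (Pi.single i (k i)) y := by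
  rw [mFourier_apply_add, mFourier_apply_pi_single, mFourier_single_int]

/-- `e_k(x − yᵢ-spike) = e_k(x) · conj e_{kᵢ eᵢ}(y)`. [cite: Grafakos2014, §3.1.1] -/
theorem mFourier_sub_pi_single (k : d → ℤ) (i : d) (x y : UnitAddTorus d) :
    mFourier k (x - Pi.single i (y i)) = mFourier k x * conj (mFourier (Pi.single i (k i)) y) := by
  have h := mFourier_add_pi_single k i (x - Pi.single i (y i)) y
  rw [sub_add_cancel] at h
  have h1 : mFourier (Pi.single i (k i)) y * conj (mFourier (Pi.single i (k i)) y) = 1 := by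
    rw [Complex.mul_conj, Complex.normSq_eq_norm_sq]
    have : ‖mFourier (Pi.single i (k i)) y‖ = 1 := by
      rw [mFourier_single_int]; exact Circle.norm_coe _
    rw [this]; norm_num
  calc mFourier k (x - Pi.single i (y i))
      = mFourier k (x - Pi.single i (y i)) * (mFourier (Pi.single i (k i)) y * conj (mFourier (Pi.single i (k i)) y)) := by
        rw [h1, mul_one]
    _ = mFourier k x * conj (mFourier (Pi.single i (k i)) y) := by rw [← mul_assoc, ← h]

/-- Powers of the axis character: `e_{a eᵢ} = (e_{eᵢ})ᵃ`. [cite: Grafakos2014, §3.1.1] -/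
theorem mFourier_single_natCast (i : d) (a : ℕ) (y : UnitAddTorus d) :
    mFourier (Pi.single i (a : ℤ)) y = mFourier (Pi.single i 1) y ^ a := by
  induction a with
  | zero =>
    rw [pow_zero, Nat.cast_zero, Pi.single_zero, mFourier_zero]
    rfl
  | succ a ih =>
    rw [pow_succ, ← ih, ← mFourier_add, ← Pi.single_add]
    push_cast
    rfl

/-! ## §2 The symbol, the Dirichlet and geometric sums, the kernel -/

/-- **The smoothed step symbol** `stepSym K Δ m = Δ⁻² #{(a,a') ∈ [0,Δ)² : |m − a + a'| ≤ K + Δ}`: `1` on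
`|m| ≤ K`, `0` on `|m| > K + 2Δ`, values in `[0,1]`, even — the indicator of `[−K−Δ, K+Δ]` smoothed by
the Fejér weights. [cite: Grafakos2014, §3.1.3] -/
def stepSym (K Δ : ℕ) (m : ℤ) : ℝ :=
  (∑ a ∈ Finset.range Δ, ∑ a' ∈ Finset.range Δ,
    if |m - a + a'| ≤ (K : ℤ) + Δ then (1 : ℝ) else 0) / (Δ : ℝ) ^ 2

/-- The Dirichlet sum along the axis `i`: `D_N(y) = Σ_{|n| ≤ N} e_{n eᵢ}(y)`, written as `e_{−N eᵢ} · Σ_{0≤j≤2N} e_{j eᵢ}`.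
[cite: Grafakos2014, §3.1.3] -/
def axisDirichlet (i : d) (N : ℕ) (y : UnitAddTorus d) : ℂ :=
  mFourier (Pi.single i (-(N : ℤ))) y * ∑ j ∈ Finset.range (2 * N + 1), mFourier (Pi.single i (j : ℤ)) y

/-- The geometric sum along the axis `i`: `G_Δ(y) = Σ_{0 ≤ a < Δ} e_{a eᵢ}(y)` (`|G_Δ|²/Δ` is the Fejér kernel).
[cite: Grafakos2014, §3.1.3] -/
def axisGeom (i : d) (Δ : ℕ) (y : UnitAddTorus d) : ℂ :=
  ∑ a ∈ Finset.range Δ, mFourier (Pi.single i (a : ℤ)) y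

/-- The complex form of the smoothed step kernel along the axis `i`: `D_{K+Δ} · G_Δ · conj G_Δ / Δ²`.
[cite: Grafakos2014, §3.1.3] -/
def stepKernelC (i : d) (K Δ : ℕ) (y : UnitAddTorus d) : ℂ :=
  axisDirichlet i (K + Δ) y * (axisGeom i Δ y * conj (axisGeom i Δ y)) / ((Δ : ℂ)) ^ 2

/-- **The smoothed step kernel** along the axis `i` (real valued): the convolution kernel on `T^d` of the
multiplier `k ↦ stepSym K Δ (k i)`. [cite: Grafakos2014, §3.1.3] -/
def stepKernel (i : d) (K Δ : ℕ) (y : UnitAddTorus d) : ℝ :=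
  (stepKernelC i K Δ y).re

/-! ## §3 The symbol: range, plateau, support, parity -/

omit [Fintype d] [DecidableEq d] in
/-- `0 ≤ stepSym K Δ m`. [cite: Grafakos2014, §3.1.3] -/
theorem stepSym_nonneg (K Δ : ℕ) (m : ℤ) : 0 ≤ stepSym K Δ m :=
  div_nonneg (Finset.sum_nonneg fun _ _ => Finset.sum_nonneg fun _ _ => by split_ifs <;> norm_num)
    (sq_nonneg _)

omit [Fintype d] [DecidableEq d] in
/-- `stepSym K Δ m ≤ 1`. [cite: Grafakos2014, §3.1.3] -/
theorem stepSym_le_one (K Δ : ℕ) (m : ℤ) : stepSym K Δ m ≤ 1 := by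
  unfold stepSym
  rcases Nat.eq_zero_or_pos Δ with hΔ | hΔ
  · subst hΔ; simp
  have hΔ' : (0 : ℝ) < (Δ : ℝ) ^ 2 := by positivity
  rw [div_le_one hΔ']
  calc ∑ a ∈ Finset.range Δ, ∑ a' ∈ Finset.range Δ, (if |m - a + a'| ≤ (K : ℤ) + Δ then (1 : ℝ) else 0)
      ≤ ∑ _a ∈ Finset.range Δ, ∑ _a' ∈ Finset.range Δ, (1 : ℝ) :=
        Finset.sum_le_sum fun a _ => Finset.sum_le_sum fun a' _ => by split_ifs <;> norm_num
    _ = (Δ : ℝ) ^ 2 := by simp [sq]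

omit [Fintype d] [DecidableEq d] in
/-- The plateau: `stepSym K Δ m = 1` for `|m| ≤ K` (and `Δ ≥ 1`). [cite: Grafakos2014, §3.1.3] -/
theorem stepSym_eq_one {K Δ : ℕ} (hΔ : 0 < Δ) {m : ℤ} (hm : |m| ≤ K) : stepSym K Δ m = 1 := by
  unfold stepSym
  have hΔ' : (0 : ℝ) < (Δ : ℝ) ^ 2 := by positivity
  rw [div_eq_one_iff_eq hΔ'.ne']
  have h : ∀ a ∈ Finset.range Δ, ∀ a' ∈ Finset.range Δ, |m - a + a'| ≤ (K : ℤ) + Δ := by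
    intro a ha a' ha'
    rw [Finset.mem_range] at ha ha'
    rw [abs_le] at hm ⊢
    constructor <;> omega
  rw [Finset.sum_congr rfl fun a ha => Finset.sum_congr rfl fun a' ha' => if_pos (h a ha a' ha')]
  simp [sq]

omit [Fintype d] [DecidableEq d] in
/-- The support: `stepSym K Δ m = 0` for `K + 2Δ < |m|`. [cite: Grafakos2014, §3.1.3] -/
theorem stepSym_eq_zero {K Δ : ℕ} {m : ℤ} (hm : (K : ℤ) + 2 * Δ < |m|) : stepSym K Δ m = 0 := by
  unfold stepSym
  rw [div_eq_zero_iff]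
  left
  refine Finset.sum_eq_zero fun a ha => Finset.sum_eq_zero fun a' ha' => ?_
  rw [Finset.mem_range] at ha ha'
  rw [if_neg]
  rw [not_le]
  rw [lt_abs] at hm ⊢
  rcases hm with hm | hm <;> [left; right] <;> omega

omit [Fintype d] [DecidableEq d] in
/-- Parity: `stepSym K Δ (−m) = stepSym K Δ m` (swap `a ↔ a'`). [cite: Grafakos2014, §3.1.3] -/
theorem stepSym_neg (K Δ : ℕ) (m : ℤ) : stepSym K Δ (-m) = stepSym K Δ m := by
  unfold stepSym
  congr 1
  rw [Finset.sum_comm]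
  refine Finset.sum_congr rfl fun a' _ => Finset.sum_congr rfl fun a _ => ?_
  have : |-m - (a : ℤ) + a'| = |m - a' + a| := by
    rw [show -m - (a : ℤ) + a' = -(m - a' + a) by ring, abs_neg]
  rw [this]

omit [Fintype d] [DecidableEq d] in
/-- The symbol vanishes off the interval `[−(K+2Δ), K+2Δ]`. [cite: Grafakos2014, §3.1.3] -/
theorem stepSym_eq_zero_of_not_mem_Icc {K Δ : ℕ} {m : ℤ} (hm : m ∉ Finset.Icc (-((K : ℤ) + 2 * Δ)) ((K : ℤ) + 2 * Δ)) :
    stepSym K Δ m = 0 := by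
  refine stepSym_eq_zero ?_
  rw [Finset.mem_Icc, not_and_or, not_le, not_le] at hm
  rw [lt_abs]
  rcases hm with hm | hm
  · right; linarith
  · left; exact hm

/-! ## §4 The kernel as a sum of characters -/

/-- Products of axis characters: `e_{m eᵢ} e_{n eᵢ} = e_{(m+n) eᵢ}`. [cite: Grafakos2014, §3.1.1] -/
theorem mFourier_single_mul (i : d) (m n : ℤ) (y : UnitAddTorus d) :
    mFourier (Pi.single i m) y * mFourier (Pi.single i n) y = mFourier (Pi.single i (m + n)) y := by
  rw [← mFourier_add, ← Pi.single_add]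

/-- Conjugates of axis characters: `conj e_{n eᵢ} = e_{−n eᵢ}`. [cite: Grafakos2014, §3.1.1] -/
theorem conj_mFourier_single (i : d) (n : ℤ) (y : UnitAddTorus d) :
    conj (mFourier (Pi.single i n) y) = mFourier (Pi.single i (-n)) y := by
  rw [← mFourier_neg, ← Pi.single_neg]

/-- **The kernel as a triple sum of characters**:
`k_C(y) = Δ⁻² Σ_{j ≤ 2N} Σ_{a<Δ} Σ_{a'<Δ} e_{(j − N + a − a') eᵢ}(y)`, `N = K + Δ`. [cite: Grafakos2014, §3.1.3] -/
theorem stepKernelC_eq_sum (i : d) (K Δ : ℕ) (y : UnitAddTorus d) :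
    stepKernelC i K Δ y = (∑ j ∈ Finset.range (2 * (K + Δ) + 1), ∑ a ∈ Finset.range Δ, ∑ a' ∈ Finset.range Δ,
      mFourier (Pi.single i ((j : ℤ) - (K + Δ : ℕ) + a - a')) y) / ((Δ : ℂ)) ^ 2 := by
  unfold stepKernelC axisDirichlet axisGeom
  congr 1
  rw [map_sum, Finset.mul_sum, Finset.sum_mul]
  refine Finset.sum_congr rfl fun j _ => ?_
  rw [Finset.sum_mul_sum, Finset.mul_sum]
  refine Finset.sum_congr rfl fun a _ => ?_
  rw [Finset.mul_sum]
  refine Finset.sum_congr rfl fun a' _ => ?_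
  rw [conj_mFourier_single, mFourier_single_mul, mFourier_single_mul, mFourier_single_mul]
  congr 2
  push_cast
  ring

/-- Orthogonality of the axis characters: `∫ e_{j eᵢ} conj e_{m eᵢ} = δ_{jm}`. [cite: Grafakos2014, §3.1.1] -/
theorem integral_mFourier_single_mul_conj (i : d) (j m : ℤ) :
    ∫ y : UnitAddTorus d, mFourier (Pi.single i j) y * conj (mFourier (Pi.single i m) y) = if j = m then (1 : ℂ) else 0 := by
  have h := integral_mFourier_neg_mul_mFourier (d := d) (Pi.single i m) (Pi.single i j)
  simp_rw [mFourier_neg, mul_comm (conj _)] at h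
  rw [h]
  by_cases hjm : j = m
  · subst hjm; rw [if_pos rfl, if_pos rfl]
  · rw [if_neg (fun h' => hjm ((Pi.single_inj i).1 h').symm), if_neg hjm]

/-- **The multiplier identity**: `∫ k_C(y) conj e_{m eᵢ}(y) dy = stepSym K Δ m` — the `m`-th Fourier coefficient of the
kernel along its axis is the symbol. [cite: Grafakos2014, §3.1.3] -/
theorem integral_stepKernelC_mul_conj_mFourier_single (i : d) (K Δ : ℕ) (m : ℤ) :
    ∫ y : UnitAddTorus d, stepKernelC i K Δ y * conj (mFourier (Pi.single i m) y) = (stepSym K Δ m : ℂ) := by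
  simp_rw [stepKernelC_eq_sum, div_mul_eq_mul_div, Finset.sum_mul]
  have hint : ∀ n : ℤ, Integrable (fun y : UnitAddTorus d => mFourier (Pi.single i n) y * conj (mFourier (Pi.single i m) y)) volume :=
    fun n => ((mFourier _).continuous.mul ((mFourier _).continuous.star)).integrable_of_hasCompactSupport
      (HasCompactSupport.of_compactSpace _)
  rw [integral_div, integral_finsetSum _ fun j _ => ?_]
  swap
  · exact integrable_finsetSum _ fun a _ => integrable_finsetSum _ fun a' _ => hint _
  simp_rw [integral_finsetSum _ fun a _ => integrable_finsetSum _ fun a' _ => hint _,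
    integral_finsetSum _ fun a' _ => hint _, integral_mFourier_single_mul_conj]
  -- evaluate the `j`-sum: exactly one `j` hits, iff `|m − a + a'| ≤ K + Δ`
  have hsum : ∀ a a' : ℕ, (∑ j ∈ Finset.range (2 * (K + Δ) + 1),
      (if ((j : ℤ) - (K + Δ : ℕ) + a - a' = m) then (1 : ℂ) else 0)) =
      if |m - a + a'| ≤ (K : ℤ) + Δ then (1 : ℂ) else 0 := by
    intro a a'
    by_cases hm : |m - a + a'| ≤ (K : ℤ) + Δ
    · rw [if_pos hm]
      have hnn : 0 ≤ m - a + a' + (K + Δ : ℕ) := by rw [abs_le] at hm; push_cast; omega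
      obtain ⟨j₀, hj₀⟩ := Int.eq_ofNat_of_zero_le hnn
      rw [Finset.sum_eq_single j₀]
      · rw [if_pos]; push_cast at hj₀ ⊢; omega
      · intro j _ hj
        rw [if_neg]
        intro h
        apply hj
        have : (j : ℤ) = j₀ := by push_cast at hj₀ h ⊢; omega
        exact_mod_cast this
      · intro hj₀'
        exfalso; apply hj₀'
        rw [Finset.mem_range]
        have : (j₀ : ℤ) < 2 * (K + Δ : ℕ) + 1 := by rw [abs_le] at hm; push_cast at hj₀ ⊢; omega
        exact_mod_cast this
    · rw [if_neg hm]
      refine Finset.sum_eq_zero fun j hj => ?_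
      rw [if_neg]
      intro h
      apply hm
      rw [Finset.mem_range] at hj
      rw [abs_le]
      have hj' : (j : ℤ) < 2 * (K + Δ : ℕ) + 1 := by exact_mod_cast hj
      constructor <;> push_cast at h hj' ⊢ <;> omega
  have hreorg : (∑ j ∈ Finset.range (2 * (K + Δ) + 1), ∑ a ∈ Finset.range Δ, ∑ a' ∈ Finset.range Δ,
      (if ((j : ℤ) - (K + Δ : ℕ) + a - a' = m) then (1 : ℂ) else 0)) =
      ∑ a ∈ Finset.range Δ, ∑ a' ∈ Finset.range Δ, ∑ j ∈ Finset.range (2 * (K + Δ) + 1),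
      (if ((j : ℤ) - (K + Δ : ℕ) + a - a' = m) then (1 : ℂ) else 0) := by
    rw [Finset.sum_comm]
    exact Finset.sum_congr rfl fun a _ => Finset.sum_comm
  rw [hreorg]
  simp_rw [hsum]
  unfold stepSym
  push_cast
  congr 1
  refine Finset.sum_congr rfl fun a _ => Finset.sum_congr rfl fun a' _ => ?_
  split_ifs <;> simp

/-- The kernel's Fourier coefficient against `e_{m eᵢ}` (no conjugate) is the symbol at `−m`, hence at `m`.
[cite: Grafakos2014, §3.1.3] -/
theorem integral_stepKernelC_mul_mFourier_single (i : d) (K Δ : ℕ) (m : ℤ) :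
    ∫ y : UnitAddTorus d, stepKernelC i K Δ y * mFourier (Pi.single i m) y = (stepSym K Δ m : ℂ) := by
  have h := integral_stepKernelC_mul_conj_mFourier_single i K Δ (-m)
  simp_rw [conj_mFourier_single, neg_neg] at h
  rw [h, stepSym_neg]

/-! ## §5 The kernel is real -/

/-- The Dirichlet sum is self-conjugate (reflect `j ↦ 2N − j`). [cite: Grafakos2014, §3.1.3] -/
theorem conj_axisDirichlet (i : d) (N : ℕ) (y : UnitAddTorus d) :
    conj (axisDirichlet i N y) = axisDirichlet i N y := by
  unfold axisDirichlet
  rw [map_mul, map_sum, conj_mFourier_single, neg_neg, Finset.mul_sum, Finset.mul_sum]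
  simp_rw [conj_mFourier_single, mFourier_single_mul]
  rw [← Finset.sum_range_reflect]
  refine Finset.sum_congr rfl fun j hj => ?_
  rw [Finset.mem_range] at hj
  congr 2
  have : ((2 * N + 1 - 1 - j : ℕ) : ℤ) = 2 * N - j := by omega
  rw [this]; ring

/-- The kernel is real: `conj k_C = k_C`. [cite: Grafakos2014, §3.1.3] -/
theorem conj_stepKernelC (i : d) (K Δ : ℕ) (y : UnitAddTorus d) :
    conj (stepKernelC i K Δ y) = stepKernelC i K Δ y := by
  unfold stepKernelC
  rw [map_div₀, map_mul, map_mul, conj_axisDirichlet, Complex.conj_conj, map_pow, Complex.conj_natCast,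
    mul_comm (conj (axisGeom i Δ y))]

/-- `(stepKernel y : ℂ) = k_C(y)`. [cite: Grafakos2014, §3.1.3] -/
theorem ofReal_stepKernel (i : d) (K Δ : ℕ) (y : UnitAddTorus d) :
    (stepKernel i K Δ y : ℂ) = stepKernelC i K Δ y := by
  rw [stepKernel]
  exact Complex.conj_eq_iff_re.1 (conj_stepKernelC i K Δ y)

/-- `‖stepKernel y‖ = ‖k_C(y)‖`. [cite: Grafakos2014, §3.1.3] -/
theorem norm_stepKernel (i : d) (K Δ : ℕ) (y : UnitAddTorus d) :
    ‖stepKernel i K Δ y‖ = ‖stepKernelC i K Δ y‖ := by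
  rw [← ofReal_stepKernel, Complex.norm_real]

/-- The kernel is continuous (a trigonometric polynomial). [cite: Grafakos2014, §3.1.3] -/
theorem continuous_stepKernelC (i : d) (K Δ : ℕ) : Continuous (stepKernelC (d := d) i K Δ) := by
  unfold stepKernelC axisDirichlet axisGeom
  fun_prop

/-- The real kernel is continuous. [cite: Grafakos2014, §3.1.3] -/
theorem continuous_stepKernel (i : d) (K Δ : ℕ) : Continuous (stepKernel (d := d) i K Δ) :=
  Complex.continuous_re.comp (continuous_stepKernelC i K Δ)

/-- **Multiplier identity, real kernel**: `∫ k(y) conj e_{m eᵢ}(y) dy = stepSym K Δ m`. [cite: Grafakos2014, §3.1.3] -/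
theorem integral_stepKernel_mul_conj_mFourier_single (i : d) (K Δ : ℕ) (m : ℤ) :
    ∫ y : UnitAddTorus d, (stepKernel i K Δ y : ℂ) * conj (mFourier (Pi.single i m) y) = (stepSym K Δ m : ℂ) := by
  simp_rw [ofReal_stepKernel]
  exact integral_stepKernelC_mul_conj_mFourier_single i K Δ m

/-- **Multiplier identity, real kernel, no conjugate**: `∫ k(y) e_{m eᵢ}(y) dy = stepSym K Δ m`. [cite: Grafakos2014, §3.1.3] -/
theorem integral_stepKernel_mul_mFourier_single (i : d) (K Δ : ℕ) (m : ℤ) :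
    ∫ y : UnitAddTorus d, (stepKernel i K Δ y : ℂ) * mFourier (Pi.single i m) y = (stepSym K Δ m : ℂ) := by
  simp_rw [ofReal_stepKernel]
  exact integral_stepKernelC_mul_mFourier_single i K Δ m

end Torus

end Literature.Analysis.FunctionSpaces

end
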